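import Literature.NumberTheory.LFunctions.Zhang2022.RepairCatalogueAuthor
import Literature.NumberTheory.LFunctions.Zhang2022.RepairGuardedRows

/-!
# Zhang (2022) repair catalogue, author-side rows: position relative to the classical conjecture
# (`NoSiegelZeros ⇒ row ⇒ Theorem 1`; degenerate ceilings of `ExponentBelow`)

Trunk T-ANT (NumberTheory/LFunctions). Companion of `RepairCatalogueAuthor` (typer seat ls-rescue-typ-1, p507467),
written by the refuter seat ls-rescue-ref-1 of the cell landau-siegel, D-0124 LS RESCUE (2). Sources as there:
Y. Zhang, arXiv:2211.02515v1 [Zhang2022LandauSiegel] and arXiv:0705.4306v1 [Zhang2007LandauSiegel] — unrefereed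
manuscripts under adjudication; **nothing here asserts or denies their theorems**; every row stays a HYPOTHESIS.

What is recorded (the refuter's finding for the rows `zhang2007Theorem1`, `zhang2007Theorem2`, `ExponentBelow B`):
each row is a CONSEQUENCE of the tree's classical conjecture `NoSiegelZeros` (through (1.1) =
`Section1.eq11Imp_holds : NoSiegelZeros → LOneLowerBound 1`, exponent monotonicity, and
`Skeleton.zeroFreeRegion_one_iff`), so — exactly like the (A)-guarded rows of `RepairGuardedRows` — a kernel
refutation of any of them would be a kernel disproof of `NoSiegelZeros`: they are excluded from refutation by
construction and sit BETWEEN the conjecture and `Skeleton.Theorem1` (summit-side restatements, not repairs of the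
refuted step). The only members a refuter can touch are the degenerate ceilings: `ExponentBelow 0` is empty and
`ExponentBelow 1` is the ABSOLUTE lower bound `L(1,χ) > c₁` (`LOneLowerBound 0`), false in print
(`L(1,χ_D) = Ω⁻¹`-type results of Chowla / Bateman–Chowla–Erdős, not in the tree) — so a catalogue row of this
shape must carry `B ≥ 2`, where `NoSiegelZeros` already implies it.
The programme SEARCHES and TYPES; no claim about Landau–Siegel zeros, Theorems 1–2 of arXiv:2211.02515 or a
repaired Margin232 until a kernel theorem says so.
-/

noncomputable section

namespace Literature.NumberTheory.LFunctions.Zhang2022.Repair.Catalogue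

open Literature.NumberTheory.LFunctions
open Literature.NumberTheory.LFunctions.Zhang2022

/-- `NoSiegelZeros ⇒` the 2007 Theorem 1 row (`LOneLowerBound 1 → LOneLowerBound 17 → zhang2007Theorem1`).
[cite: Zhang2007LandauSiegel, §1 Theorem 1 (1.1)] -/
theorem zhang2007Theorem1_of_noSiegelZeros (h : NoSiegelZeros) : zhang2007Theorem1 :=
  zhang2007Theorem1_sandwich.1 (Section1.lOneLowerBound_mono (by norm_num) (Section1.eq11Imp_holds h))

/-- `NoSiegelZeros ⇒` the 2007 Theorem 2 row (`ZeroFreeRegion 1 ↔ NoSiegelZeros`, monotonicity, sandwich).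
[cite: Zhang2007LandauSiegel, §1 Theorem 2] -/
theorem zhang2007Theorem2_of_noSiegelZeros (h : NoSiegelZeros) : zhang2007Theorem2 :=
  zhang2007Theorem2_sandwich.1 (zeroFreeRegion_mono (by norm_num) (Skeleton.zeroFreeRegion_one_iff.2 h))

/-- `NoSiegelZeros ⇒ ExponentBelow B` for every ceiling `B ≥ 2` (witness exponent `A = 1`, (1.1)).
[cite: Zhang2022LandauSiegel, §1 (1.1) p. 2; §1 Theorem 1] -/
theorem exponentBelow_of_noSiegelZeros {B : ℕ} (hB : 2 ≤ B) (h : NoSiegelZeros) : ExponentBelow B :=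
  ⟨1, by omega, Section1.eq11Imp_holds h⟩

/-- Degenerate ceiling `0`: the row is empty (no exponent below `0`). [cite: Zhang2022LandauSiegel, §1 Theorem 1] -/
theorem not_exponentBelow_zero : ¬ ExponentBelow 0 := fun ⟨A, hA, _⟩ => Nat.not_lt_zero A hA

/-- Degenerate ceiling `1`: the row IS the absolute lower bound `L(1,χ) > c₁` (exponent `0`) — false in print
(not a tree fact); rows of this shape need `B ≥ 2`. [cite: Zhang2022LandauSiegel, §1 Theorem 1] -/
theorem exponentBelow_one_iff : ExponentBelow 1 ↔ Skeleton.LOneLowerBound 0 :=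
  ⟨fun ⟨A, hA, hL⟩ => by
    obtain rfl : A = 0 := by omega
    exact hL, fun h => ⟨0, by omega, h⟩⟩

/-- `ExponentBelow B` with `B ≤ 2022` switches Assumption (A) off for every large modulus (so it, too, proves every
(A)-guarded row: `KnifeEdgeEll.Vernier.forAllLarge_guarded_of_notA`). [cite: Zhang2022LandauSiegel, §2 Assumption (A) p. 4] -/
theorem notAEventually_of_exponentBelow {B : ℕ} (hB : B ≤ 2022) (h : ExponentBelow B) :
    Skeleton.ForAllLarge fun D _ χ => ¬ Skeleton.AssumptionA D χ := by
  obtain ⟨A, hA, hL⟩ := h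
  exact Guarded.notAEventually_of_lOneLowerBound (by omega) hL

/-- **Position of the author-side rows**: `NoSiegelZeros ⇒ row ⇒ Theorem 1 / Theorem 2`, both arrows kernel facts
(`B ∈ [2, 2023]` for the exponent rows). [cite: Zhang2007LandauSiegel, §1 Theorems 1–2] -/
theorem rows_between_conjecture_and_theorem1 :
    (NoSiegelZeros → zhang2007Theorem1) ∧ (zhang2007Theorem1 → Skeleton.Theorem1) ∧
    (NoSiegelZeros → zhang2007Theorem2) ∧ (zhang2007Theorem2 → Skeleton.Theorem2) ∧
    (∀ B, 2 ≤ B → B ≤ 2023 → (NoSiegelZeros → ExponentBelow B) ∧ (ExponentBelow B → Skeleton.Theorem1)) :=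
  ⟨zhang2007Theorem1_of_noSiegelZeros, theorem1_of_zhang2007Theorem1, zhang2007Theorem2_of_noSiegelZeros,
    theorem2_of_zhang2007Theorem2,
    fun _ h2 h2023 => ⟨exponentBelow_of_noSiegelZeros h2, theorem1_of_exponentBelow h2023⟩⟩

end Literature.NumberTheory.LFunctions.Zhang2022.Repair.Catalogue

end
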